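import Summits.BirchSwinnertonDyer.BirchSwinnertonDyer.Theorems.TangentConeSelmerRankSmallImageReduction

/-!
# BirchSwinnertonDyer / TangentCone, SelmerRank — the exact open kernel of the crux
`SelmerRankSmallImage` (stmt-BirchSwinnertonDyer-14418): rank BSD for CM curves

The crux `SelmerRankSmallImage` (byte-identical decl in routes TangentCone, SelmerRank,
ShadowIsolation, ToricShedding, FrozenTwin) is Selmer-rank BSD at ONE good ordinary prime `p ≥ 5`
with NON-surjective `ρ̄_{E,p}`: `corank_{ℤ_p} Sel_{p^∞}(E/ℚ) = ord_{s=1} L(E,s)`.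

`TangentConeSelmerRankSmallImageReduction` (p146239) reduced the crux, inside each wanting route,
to the route's own items, THREE named facts (Burungale–Tian `p`-converses ×2, Dokchitser–Dokchitser
parity) and a CM core stated at the prime `p`. This file sharpens that: the three named facts are
NOT needed. Under the routes' own item `SelmerRankShaPFinite` (stmt-0132, `Ш[ℓ^∞]` finite at every
prime) Greenberg's identity `corank Sel_{ℓ^∞} = rank E(ℚ) + corank Ш[ℓ^∞]` (tree THEOREM
`selmerCorank_eq_mordellWeilRank_add_holds`) makes the Selmer corank equal to the Mordell–Weil
rank at EVERY prime (`selmerCorank_eq_mordellWeilRank_of_shaPFinite`), so the crux is a statement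
about `rank E(ℚ)`; for non-CM curves of analytic rank `≥ 2` the rank is read at a Serre big-image
prime (`exists_goodOrdinary_surjective_of_not_hasCM`, proved) from the routes' big-image items,
for analytic rank `≤ 1` it is Gross–Zagier–Kolyvagin (TangentCone's item `RankLeOne`), and what is
left is ONE classical statement, spelled out verbatim as a hypothesis (never a definition, never
a named fact):

  `CMRank≥2`: for every elliptic `E/ℚ` (globally minimal `W`) with complex multiplication and
  `ord_{s=1} L(E,s) ≥ 2`, `rank_ℤ E(ℚ) = ord_{s=1} L(E,s)` — the rank part of the Birch and
  Swinnerton-Dyer conjecture for CM curves in analytic rank `≥ 2` (OPEN: Coates–Wiles 1977,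
  Rubin 1987/1991, Burungale–Tian cover analytic rank / corank `≤ 1` only).

Main theorems (all CONDITIONAL implications between open statements; no `sorry`, no new axiom):
* `tangentCone_selmerRankSmallImage_of_cmCore` — route TangentCone: `EdgeDecay → EdgeCap →
  SelmerRankLB → SelmerRankShaPFinite → RankLeOne → CMCore → SelmerRankSmallImage`, where
  `CMCore` is the crux restricted to CM curves of analytic rank `≥ 2` (the registered stub
  `stub_cmCore` of line `prime-switch`, verbatim) — the line's composition with every other stub
  discharged by route items;
* `tangentCone_selmerRankSmallImage_of_cmRank` — route TangentCone: `EdgeDecay → EdgeCap →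
  SelmerRankLB → SelmerRankShaPFinite → RankLeOne → CMRank≥2 → SelmerRankSmallImage`;
* `tangentCone_selmerRankSmallImage_of_cmAnchor` — the same with the CM hypothesis in the weaker
  looking `∃`-corank form `∃ q prime, corank_q = r_an` (equivalent under `SelmerRankShaPFinite`);
* `selmerRank_selmerRankSmallImage_of_cmRank` — route SelmerRank: `UB → LB → ShaPFinite → GZK →
  CMRank≥2 → SelmerRankSmallImage`;
* `cmRank_of_selmerRankSmallImage` — CONVERSELY, `SelmerRankShaPFinite → SelmerRankSmallImage →`
  (every globally minimal CM curve has a good ordinary prime `p ≥ 5` with non-surjective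
  `ρ̄_{E,p}`) `→` rank BSD for CM curves (in every analytic rank). The small-image prime supply
  for CM curves is printed (Deuring: the ordinary primes of a CM curve are the split ones, density
  `1/2`; Serre 1972 §4.5 / Zywina 2015 Prop. 1.14: the mod-`p` image of a CM curve lies in the
  normaliser of a Cartan subgroup, so is never surjective for odd `p`) and is taken here as an
  explicit hypothesis, the tree's `zywina2015_cm_modEll_not_surjective` being a cite-only fact.

So, modulo the routes' sibling items and that supply, the crux IS rank BSD for CM curves in
analytic rank `≥ 2`: this is the line lead's formal ground for `promote-stub` (line `prime-switch`,
stub `stub_cmHighCore`). Supports stmt-BirchSwinnertonDyer-14418 (it does not close it).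
-/

-- D-0017: single-problem summit, so `Summit.BirchSwinnertonDyer.BirchSwinnertonDyer.…` repeats a
-- namespace BY DESIGN.
set_option linter.dupNamespace false

namespace Summit.BirchSwinnertonDyer.BirchSwinnertonDyer.Theorems

open Summit.BirchSwinnertonDyer.BirchSwinnertonDyer.Theses
open Literature.NumberTheory.EllipticCurves

/-! ### Under prime-by-prime `Ш`-finiteness the Selmer corank is the rank -/

/-- **Greenberg's identity under `Ш[p^∞]`-finiteness.** If `Ш(E/ℚ)[p^∞]` is finite at every prime
(the routes' item `SelmerRankShaPFinite`, stmt-0132) then `corank_{ℤ_p} Sel_{p^∞}(E/ℚ) = rank E(ℚ)`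
at every prime `p`: `corank Sel_{p^∞} = rank + corank Ш[p^∞]` (tree theorem
`selmerCorank_eq_mordellWeilRank_add_holds`) and a finite `p`-primary group has corank `0`
(`Literature.BSD.shaCorank_eq_zero_of_finite`). [cite: GreenbergLNM1716, §1] -/
theorem selmerCorank_eq_mordellWeilRank_of_shaPFinite
    (hSha : ∀ (W : WeierstrassCurve ℚ) [W.IsElliptic] (p : ℕ) [Fact p.Prime],
      Finite (AddCommGroup.primaryComponent W.sha p))
    (W : WeierstrassCurve ℚ) [W.IsElliptic] (p : ℕ) [Fact p.Prime] :
    W.selmerCorank p = W.mordellWeilRank := by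
  rw [W.selmerCorank_eq_mordellWeilRank_add_holds p,
    Literature.BSD.shaCorank_eq_zero_of_finite W p (hSha W p), add_zero]

/-! ### The big-image anchor of route TangentCone (edge squeeze) -/

/-- **Big-image anchor from TangentCone's `EdgeDecay ∧ EdgeCap ∧ SelmerRankLB`.** If `E/ℚ`
(globally minimal `W`) has SOME good ordinary prime `p₀ ≥ 5` with surjective `ρ̄_{E,p₀}` and
`ord_{s=1} L(E,s) ≥ 2`, then at the admissible prime `p` returned by `EdgeDecay` (good ordinary,
`≥ 5`, surjective image) the edge ratios decay at rate `≥ corank_p` (`EdgeCap`) and at rate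
`≤ r_an` (`EdgeDecay`), whence `corank_p ≤ r_an` (verbatim the surjective branch of the route's
certified `closes`), and `SelmerRankLB` gives the other inequality. [cite: GreenbergStevens1993, p. 413] -/
theorem exists_bigImage_selmerCorank_eq_of_edge (hE : TangentCone.EdgeDecay)
    (hC : TangentCone.EdgeCap) (hLB : TangentCone.SelmerRankLB) (V : WeierstrassCurve ℚ)
    [V.IsElliptic] [V.IsGloballyMinimal]
    (hex : ∃ (p₀ : ℕ) (_ : Fact p₀.Prime), 5 ≤ p₀ ∧ V.HasGoodReductionAtPrime p₀ ∧
      ¬ (p₀ : ℤ) ∣ V.frobeniusTrace p₀ ∧ V.HasSurjectiveModNGaloisRep p₀)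
    (h2 : 2 ≤ V.analyticRank) :
    ∃ (q : ℕ) (_ : Fact q.Prime), 5 ≤ q ∧ V.HasGoodReductionAtPrime q ∧
      ¬ (q : ℤ) ∣ V.frobeniusTrace q ∧ V.HasSurjectiveModNGaloisRep q ∧
        V.selmerCorank q = V.analyticRank := by
  obtain ⟨hN, p, hp, h5', hgood', hord', hna, hsurj', hBr, a, b, hb, hab, hJ⟩ := hE V h2 hex
  obtain ⟨J, C₁, hcap⟩ := hC V hN p h5' hgood' hord' hna hsurj' hBr a b hb hab
  obtain ⟨C₂, hm⟩ := hJ J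
  have hp1 : (1 : ℝ) < (p : ℝ) := by exact_mod_cast hp.out.one_lt
  have hp0 : (0 : ℝ) < (p : ℝ) := lt_trans zero_lt_one hp1
  have key : ∀ m : ℕ, V.selmerCorank p * (1 + m) ≤ V.analyticRank * (m + 1) + (C₁ + C₂) := by
    intro m
    obtain ⟨k, g, ι, s, hdiv, hkJ, hs, hnew, hordg, hcong, hall⟩ := hm m
    have hdiv' : (2 * b * (p - 1) : ℤ) ∣ (k - 2) := (Dvd.intro _ rfl).trans hdiv
    obtain ⟨j, hjodd, hj3, hjJ, hcapj⟩ := hcap k g ι s hdiv' hkJ hs hnew hordg hcong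
    obtain ⟨hR, hlow⟩ := hall j hjodd hj3 hjJ
    have hup := hcapj hR
    have hk0 : (k - 2) ≠ 0 := by omega
    have hpm : ((p : ℤ) ^ m) ∣ (k - 2) := (Dvd.intro_left _ rfl).trans hdiv
    have hmv : m ≤ padicValInt p (k - 2) := by
      rcases (padicValInt_dvd_iff m (k - 2)).mp hpm with h | h
      · exact absurd h hk0
      · exact h
    set x : ℝ := ‖ι ⟨_, hR⟩‖ with hx
    have hx0 : 0 ≤ x := norm_nonneg _
    set e₁ : ℕ := V.selmerCorank p * (1 + padicValInt p (k - 2)) with he₁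
    set e₂ : ℕ := V.analyticRank * (m + 1) + C₂ with he₂
    have hpow : (p : ℝ) ^ e₁ ≤ (p : ℝ) ^ (C₁ + e₂) := by
      calc (p : ℝ) ^ e₁ = (p : ℝ) ^ e₁ * 1 := by ring
        _ ≤ (p : ℝ) ^ e₁ * (x * (p : ℝ) ^ e₂) :=
            mul_le_mul_of_nonneg_left hlow (pow_nonneg hp0.le _)
        _ = (x * (p : ℝ) ^ e₁) * (p : ℝ) ^ e₂ := by ring
        _ ≤ (p : ℝ) ^ C₁ * (p : ℝ) ^ e₂ :=
            mul_le_mul_of_nonneg_right hup (pow_nonneg hp0.le _)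
        _ = (p : ℝ) ^ (C₁ + e₂) := (pow_add (p : ℝ) C₁ e₂).symm
    have hexp : e₁ ≤ C₁ + e₂ := (pow_le_pow_iff_right₀ hp1).mp hpow
    have hmono : V.selmerCorank p * (1 + m) ≤ e₁ :=
      Nat.mul_le_mul_left _ (by omega)
    omega
  have hUB : V.selmerCorank p ≤ V.analyticRank := by
    have hk := key (C₁ + C₂)
    by_contra hlt
    push Not at hlt
    have h1 : (V.analyticRank + 1) * (1 + (C₁ + C₂)) ≤ V.selmerCorank p * (1 + (C₁ + C₂)) :=
      Nat.mul_le_mul_right _ hlt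
    nlinarith
  exact ⟨p, hp, h5', hgood', hord', hsurj', le_antisymm hUB (hLB V p h5' hgood' hord' hsurj')⟩

/-! ### The crux from the routes' items and its CM restriction (the line's registered CM stub) -/

/-- **Route TangentCone: `SelmerRankSmallImage` from the route's other items and the crux's own CM
restriction in analytic rank `≥ 2`** — the composition of line `prime-switch` (registered stub
`stub_cmCore`, spelled out verbatim as the last hypothesis) with the TRANSFER and ANCHOR stubs
discharged by the route items and GZK by `RankLeOne`. Proof: `r_an ≤ 1` — `RankLeOne` with the
corank identity; CM — the hypothesis; non-CM — a Serre prime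
(`exists_goodOrdinary_surjective_of_not_hasCM`), the edge anchor there
(`exists_bigImage_selmerCorank_eq_of_edge`), transferred to `p` by `SelmerRankShaPFinite`
(`selmerCorank_eq_selmerCorank_of_shaPFinite`). No Burungale–Tian / Dokchitser–Dokchitser input is
used (cf. `tangentCone_selmerRankSmallImage_of_items`). CONDITIONAL. [folklore] -/
theorem tangentCone_selmerRankSmallImage_of_cmCore :
    Summit.BirchSwinnertonDyer.BirchSwinnertonDyer.Theses.TangentCone.EdgeDecay →
    Summit.BirchSwinnertonDyer.BirchSwinnertonDyer.Theses.TangentCone.EdgeCap →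
    Summit.BirchSwinnertonDyer.BirchSwinnertonDyer.Theses.TangentCone.SelmerRankLB →
    Summit.BirchSwinnertonDyer.BirchSwinnertonDyer.Theses.TangentCone.SelmerRankShaPFinite →
    Summit.BirchSwinnertonDyer.BirchSwinnertonDyer.Theses.TangentCone.RankLeOne →
    (∀ (W : WeierstrassCurve ℚ) [W.IsElliptic] [W.IsGloballyMinimal] (p : ℕ) [Fact p.Prime],
      5 ≤ p → W.HasGoodReductionAtPrime p → ¬ (p : ℤ) ∣ W.frobeniusTrace p → W.HasCM →
        2 ≤ W.analyticRank → W.selmerCorank p = W.analyticRank) →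
    Summit.BirchSwinnertonDyer.BirchSwinnertonDyer.Theses.TangentCone.SelmerRankSmallImage := by
  intro hE hC hLB hSha hR1 hCore W _ _ p _ h5 hgood hord _hns
  by_cases hr1 : W.analyticRank ≤ 1
  · -- analytic rank ≤ 1: Gross–Zagier–Kolyvagin (the route item `RankLeOne`) + corank identity
    exact selmerCorank_eq_analyticRank_of_analyticRank_le_one hR1 W p hr1
  · have h2 : 2 ≤ W.analyticRank := by omega
    by_cases hW : W.HasCM
    · -- CM: the open kernel, at the prime `p` itself
      exact hCore W p h5 hgood hord hW h2
    · -- non-CM: Serre prime, edge anchor there, transfer by Ш-finiteness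
      obtain ⟨q, hq, -, -, -, -, hcor⟩ :=
        exists_bigImage_selmerCorank_eq_of_edge hE hC hLB W
          (exists_goodOrdinary_surjective_of_not_hasCM W hW) h2
      rw [← hcor]
      exact selmerCorank_eq_selmerCorank_of_shaPFinite hSha W p q

/-- **Route TangentCone: `SelmerRankSmallImage` from the route's other items and rank BSD for CM
curves in analytic rank `≥ 2`.** Hypotheses: the route items `EdgeDecay`, `EdgeCap`,
`SelmerRankLB`, `SelmerRankShaPFinite`, `RankLeOne` (= Gross–Zagier–Kolyvagin), and `hCM`: for
every globally minimal CM curve of analytic rank `≥ 2`, `rank E(ℚ) = ord_{s=1} L(E,s)` (OPEN —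
spelled out verbatim, not a definition or named fact). Proof: by `SelmerRankShaPFinite` the Selmer
corank at the given prime is the rank (`selmerCorank_eq_mordellWeilRank_of_shaPFinite`);
`r_an ≤ 1` — `RankLeOne`; CM — `hCM`; non-CM — a Serre prime
(`exists_goodOrdinary_surjective_of_not_hasCM`), the edge anchor there
(`exists_bigImage_selmerCorank_eq_of_edge`), read as the rank by `SelmerRankShaPFinite` again.
No Burungale–Tian / Dokchitser–Dokchitser input is used. CONDITIONAL. [folklore] -/
theorem tangentCone_selmerRankSmallImage_of_cmRank :
    Summit.BirchSwinnertonDyer.BirchSwinnertonDyer.Theses.TangentCone.EdgeDecay →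
    Summit.BirchSwinnertonDyer.BirchSwinnertonDyer.Theses.TangentCone.EdgeCap →
    Summit.BirchSwinnertonDyer.BirchSwinnertonDyer.Theses.TangentCone.SelmerRankLB →
    Summit.BirchSwinnertonDyer.BirchSwinnertonDyer.Theses.TangentCone.SelmerRankShaPFinite →
    Summit.BirchSwinnertonDyer.BirchSwinnertonDyer.Theses.TangentCone.RankLeOne →
    (∀ (W : WeierstrassCurve ℚ) [W.IsElliptic] [W.IsGloballyMinimal], W.HasCM →
      2 ≤ W.analyticRank → W.mordellWeilRank = W.analyticRank) →
    Summit.BirchSwinnertonDyer.BirchSwinnertonDyer.Theses.TangentCone.SelmerRankSmallImage := by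
  intro hE hC hLB hSha hR1 hCM W _ _ p _ _h5 _hgood _hord _hns
  rw [selmerCorank_eq_mordellWeilRank_of_shaPFinite hSha W p]
  by_cases hr1 : W.analyticRank ≤ 1
  · -- analytic rank ≤ 1: Gross–Zagier–Kolyvagin (the route item `RankLeOne`)
    exact (hR1 W hr1).1
  · have h2 : 2 ≤ W.analyticRank := by omega
    by_cases hW : W.HasCM
    · -- CM: the open kernel
      exact hCM W hW h2
    · -- non-CM: Serre prime, edge anchor there, read as the rank by Ш-finiteness
      obtain ⟨q, hq, -, -, -, -, hcor⟩ :=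
        exists_bigImage_selmerCorank_eq_of_edge hE hC hLB W
          (exists_goodOrdinary_surjective_of_not_hasCM W hW) h2
      rw [← selmerCorank_eq_mordellWeilRank_of_shaPFinite hSha W q, hcor]

/-- **The same with the CM hypothesis in `∃`-corank form** ("CM anchor": every globally minimal CM
curve of analytic rank `≥ 2` has SOME prime `q` with `corank_q Sel_{q^∞} = r_an` — the shape a
re-glued `closes` would consume; under `SelmerRankShaPFinite` it is equivalent to the rank form,
`selmerCorank_eq_mordellWeilRank_of_shaPFinite`). CONDITIONAL. [folklore] -/
theorem tangentCone_selmerRankSmallImage_of_cmAnchor :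
    Summit.BirchSwinnertonDyer.BirchSwinnertonDyer.Theses.TangentCone.EdgeDecay →
    Summit.BirchSwinnertonDyer.BirchSwinnertonDyer.Theses.TangentCone.EdgeCap →
    Summit.BirchSwinnertonDyer.BirchSwinnertonDyer.Theses.TangentCone.SelmerRankLB →
    Summit.BirchSwinnertonDyer.BirchSwinnertonDyer.Theses.TangentCone.SelmerRankShaPFinite →
    Summit.BirchSwinnertonDyer.BirchSwinnertonDyer.Theses.TangentCone.RankLeOne →
    (∀ (W : WeierstrassCurve ℚ) [W.IsElliptic] [W.IsGloballyMinimal], W.HasCM →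
      2 ≤ W.analyticRank → ∃ (q : ℕ) (_ : Fact q.Prime), W.selmerCorank q = W.analyticRank) →
    Summit.BirchSwinnertonDyer.BirchSwinnertonDyer.Theses.TangentCone.SelmerRankSmallImage := by
  intro hE hC hLB hSha hR1 hAnchor
  refine tangentCone_selmerRankSmallImage_of_cmRank hE hC hLB hSha hR1 fun W _ _ hW h2 => ?_
  obtain ⟨q, hq, hcor⟩ := hAnchor W hW h2
  rw [← selmerCorank_eq_mordellWeilRank_of_shaPFinite hSha W q, hcor]

/-- **Route SelmerRank: `SelmerRankSmallImage` from `SelmerRankUB`, `SelmerRankLB`,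
`SelmerRankShaPFinite`, Gross–Zagier–Kolyvagin and rank BSD for CM curves in analytic rank `≥ 2`.**
As `tangentCone_selmerRankSmallImage_of_cmRank`, with the big-image anchor `corank_q = r_an` taken
directly from `UB ∧ LB` at the Serre prime and GZK as the named fact
`rank_eq_analyticRank_of_analyticRank_le_one` (route SelmerRank carries no `RankLeOne` item).
Routes ShadowIsolation / ToricShedding / FrozenTwin carry the same `UB`-type, `LB` and `Ш` items up
to spelling. CONDITIONAL. [folklore] -/
theorem selmerRank_selmerRankSmallImage_of_cmRank (hUB : SelmerRank.SelmerRankUB)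
    (hLB : SelmerRank.SelmerRankLB) (hSha : SelmerRank.SelmerRankShaPFinite)
    (hGZK : rank_eq_analyticRank_of_analyticRank_le_one)
    (hCM : ∀ (W : WeierstrassCurve ℚ) [W.IsElliptic] [W.IsGloballyMinimal], W.HasCM →
      2 ≤ W.analyticRank → W.mordellWeilRank = W.analyticRank) :
    SelmerRank.SelmerRankSmallImage := by
  intro W _ _ p _ _h5 _hgood _hord _hns
  rw [selmerCorank_eq_mordellWeilRank_of_shaPFinite hSha W p]
  by_cases hr1 : W.analyticRank ≤ 1
  · exact (hGZK W hr1).1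
  · have h2 : 2 ≤ W.analyticRank := by omega
    by_cases hW : W.HasCM
    · exact hCM W hW h2
    · obtain ⟨q, hq, h5q, hgoodq, hordq, hsurjq⟩ := exists_goodOrdinary_surjective_of_not_hasCM W hW
      rw [← selmerCorank_eq_mordellWeilRank_of_shaPFinite hSha W q]
      exact le_antisymm (hUB W q h5q hgoodq hordq hsurjq) (hLB W q h5q hgoodq hordq hsurjq)

/-! ### Conversely: the crux contains rank BSD for CM curves -/

/-- **The crux gives back rank BSD for CM curves** (so, modulo the routes' items and the CM
small-image prime supply, `SelmerRankSmallImage` is EXACTLY rank BSD for CM curves in analytic rank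
`≥ 2`). Hypotheses: `SelmerRankShaPFinite`; the crux; and `hSupply`: every globally minimal CM
curve over `ℚ` has a good ordinary prime `p ≥ 5` at which `ρ̄_{E,p}` is not surjective (printed:
the ordinary primes of a CM curve are the primes split in the CM field — Deuring — and the mod-`p`
image of a CM curve lies in the normaliser of a Cartan subgroup, a proper subgroup of `GL₂(𝔽_p)`
for odd `p` — Serre 1972 §4.5, Zywina 2015 Prop. 1.14/1.16; cite-only in the tree, hence a
hypothesis here). Conclusion: `rank E(ℚ) = ord_{s=1} L(E,s)` for every globally minimal CM curve
(every analytic rank). Proof: at the supplied prime the crux gives `corank_p = r_an`, and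
`corank_p = rank` by `SelmerRankShaPFinite`. CONDITIONAL. [cite: Zywina2015, Prop. 1.14 and Prop. 1.16] -/
theorem cmRank_of_selmerRankSmallImage
    (hSha : Summit.BirchSwinnertonDyer.BirchSwinnertonDyer.Theses.TangentCone.SelmerRankShaPFinite)
    (hSI : Summit.BirchSwinnertonDyer.BirchSwinnertonDyer.Theses.TangentCone.SelmerRankSmallImage)
    (hSupply : ∀ (W : WeierstrassCurve ℚ) [W.IsElliptic] [W.IsGloballyMinimal], W.HasCM →
      ∃ (p : ℕ) (_ : Fact p.Prime), 5 ≤ p ∧ W.HasGoodReductionAtPrime p ∧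
        ¬ (p : ℤ) ∣ W.frobeniusTrace p ∧ ¬ W.HasSurjectiveModNGaloisRep p)
    (W : WeierstrassCurve ℚ) [W.IsElliptic] [W.IsGloballyMinimal] (hW : W.HasCM) :
    W.mordellWeilRank = W.analyticRank := by
  obtain ⟨p, hp, h5, hgood, hord, hns⟩ := hSupply W hW
  rw [← selmerCorank_eq_mordellWeilRank_of_shaPFinite hSha W p]
  exact hSI W p h5 hgood hord hns

end Summit.BirchSwinnertonDyer.BirchSwinnertonDyer.Theorems
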